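import Literature.NumberTheory.EllipticCurves.PNewBranchAnalyticChartTwoVariableBDP
import HarnessLib

/-!
# Crux 4 `BSDpOnCellC` (stmt-BirchSwinnertonDyer-19034), line `telescope` — the datum (dist) «the member points `x_t` of the branch chart
# are non-zero and take infinitely many values» is a THEOREM of the carrier's chart `IsPNewBranchAnalyticChart`
# (helper, `--supports stmt-BirchSwinnertonDyer-19034 --as helper`; closes nothing)

Cell `bsd-eis`, width seat `bsd-line-x2-p2` (prover g21, 2026-08-30; D-0154 KEY row 5). THEOREMS ONLY: no definition, no named fact,
no `sorry`, no instance, no notation. Host g36's booking l.6541 asked whether the distinctness / infinitude of the fibre points `x_k` used by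
the generic-fibre road (a′) (this seat's `…TelescopeK2GenericFibreZero`, `…InertiaDefectFiniteOfFibres`, memo #46) is derivable. Answer:
NOT from the v10 prefix of N1/N2′/N3′ (which carries only `‖x k‖ < 1`, `x → 0` and per-`k` data — `x ≡ 0` is consistent with it), but YES
from the carrier's chart predicate `IsPNewBranchAnalyticChart W p ι j A x D` (T-An-1, `castella2020_…`/Hida's chart), whose clause (wt)
`p^M · x_t = k_t − 2` with `k_t > 2` (`HidaCongruentForm.two_lt_k`) forces `x_t ≠ 0`, and whose clause (pts) `x → 0` then forces the
range of `x` to be INFINITE (a sequence avoiding its limit cannot take finitely many values in a T₁ space):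

* `infinite_range_of_tendsto_of_forall_ne` — generic: `x → a`, `x n ≠ a` for all `n`, `T1Space` ⇒ `Set.range x` infinite.
* `chart_x_ne_zero`, `chart_infinite_range`, `chart_infinite_image_univ`
  (the `(x '' 𝒦).Infinite` shape with `𝒦 = univ` consumed by `…InertiaDefectFiniteOfFibres.exists_pow_inertiaDefect_of_fibres`).

So (dist) can enter a v11 prefix at zero cost (re-port of `carrierAn_of_castella2020` by projection), or be consumed directly where the
chart is in scope. Nothing about any curve's BSD is asserted.

HONEST FRAMING: bookkeeping on a typed chart predicate; no registered stub, crux or summit statement is proved by this file; closes: none.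

References: [Hida1986] Cor. 1.4, Cor. 1.6; [Venerucci2016] §2.4 (arXiv:1407.1913, the weight disc `U`); [GreenbergStevens1993] §2.
-/

noncomputable section

-- D-0017: single-problem summit, the namespace repeats the problem name by design.
set_option linter.dupNamespace false
set_option autoImplicit false

open Filter Topology
open Literature.NumberTheory.EllipticCurves

namespace Summit.BirchSwinnertonDyer.BirchSwinnertonDyer.Theorems.TelescopeChartDistinctFibres

/-- **A convergent sequence avoiding its limit takes infinitely many values** (in a T₁ space): the complement of the finite set
`range x` would be a neighbourhood of the limit `a ∉ range x`, contradicting convergence. [folklore] -/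
theorem infinite_range_of_tendsto_of_forall_ne {α : Type*} [TopologicalSpace α] [T1Space α] {x : ℕ → α} {a : α}
    (h : Tendsto x atTop (𝓝 a)) (hne : ∀ n, x n ≠ a) : (Set.range x).Infinite := by
  intro hfin
  have ha : a ∉ Set.range x := by
    rintro ⟨n, hn⟩
    exact hne n hn
  have hmem : (Set.range x)ᶜ ∈ 𝓝 a := hfin.isClosed.compl_mem_nhds ha
  obtain ⟨n, hn⟩ := (Filter.eventually_atTop.1 (h hmem))
  exact hn n le_rfl ⟨n, rfl⟩

variable {W : WeierstrassCurve ℚ} [W.IsGloballyMinimal] {p : ℕ} [Fact p.Prime]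
  {ι : PadicAlgCl p ≃+* ℂ} {j : ℤ_[p] →+* unrIntegers p} {A : ℕ → UnrSeries p} {x : ℕ → ℤ_[p]}
  {D : ℕ → Skinner2016.HidaCongruentForm W p 1}

/-- **(wt) + `k_t > 2` ⇒ `x_t ≠ 0`**: the member points of the branch chart avoid the centre (the point of `f_E` itself).
[cite: Venerucci2016, §2.4 (p^M x = k − 2 on the weight disc)] [cite: Hida1986, Cor. 1.4] -/
theorem chart_x_ne_zero (h : IsPNewBranchAnalyticChart W p ι j A x D) (t : ℕ) : x t ≠ 0 := by
  obtain ⟨M, hM⟩ := h.exists_pow_mul_eq_weight_sub_two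
  intro h0
  have h1 := hM t
  rw [h0, mul_zero] at h1
  have h2 : (((D t).k - 2 : ℤ) : ℤ_[p]) = 0 := h1.symm
  have h3 : ((D t).k - 2 : ℤ) = 0 := by exact_mod_cast h2
  have h4 := (D t).two_lt_k
  omega

/-- **(dist) from the chart: the member points take infinitely many values.** [cite: Venerucci2016, §2.4] [cite: Hida1986, Cor. 1.4, Cor. 1.6] -/
theorem chart_infinite_range (h : IsPNewBranchAnalyticChart W p ι j A x D) : (Set.range x).Infinite :=
  infinite_range_of_tendsto_of_forall_ne h.tendsto_zero (chart_x_ne_zero h)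

/-- (dist) in the `x '' 𝒦` shape (`𝒦 = univ`) consumed by `TelescopeK2InertiaDefectFiniteOfFibres.exists_pow_inertiaDefect_of_fibres`.
[cite: Venerucci2016, §2.4] -/
theorem chart_infinite_image_univ (h : IsPNewBranchAnalyticChart W p ι j A x D) :
    (x '' (Set.univ : Set ℕ)).Infinite := by
  rw [Set.image_univ]
  exact chart_infinite_range h

end Summit.BirchSwinnertonDyer.BirchSwinnertonDyer.Theorems.TelescopeChartDistinctFibres

end
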